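import Mathlib
import Literature.Analysis.FluidPDE.Tao2016AveragedNS.RenormalisedCascadeWaves
import Summits.NavierStokesRegularity.NavierStokesRegularity.Theorems.TaoLadderRungTwoBreakNoSurvivingEternalViscBddOneContinuumCharacteristic
import HarnessLib

/-!
# Crux `TaoLadderRungTwoBreak.NoSurvivingEternalViscBddOne` (stmt-NavierStokesRegularity-20419), remaining lemma (W1):
# the SONIC BARRIER of the continuum limit — the level set `U = 1/2` travels at EXACTLY the Kolmogorov speed `3/2`,
# so EVERY ancient front (self-similar or not) is Kolmogorov-fast or dies (kernel anchor for the census of 4-g23)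

MODEL/heuristic layer only (elementary calculus on the characteristic system of the continuum limit of the positive dyadic
lattice); nothing here is a statement about the Navier–Stokes equations or about the lattice items, and no stub, crux, rung or
summit is proved (`--supports stmt-NavierStokesRegularity-20419`).  Companion of `…ContinuumCharacteristic` /
`…ContinuumEntropySelection` (hands 4-g9…4-g12), which pin the Kolmogorov exponent for SELF-SIMILAR continuum fronts (similarity
class `E = (t⋆−τ)^a G(η)`, sonic regularity / entropy shocks).  Their memo leaves the caveat «ancient solutions»: the items quantify
over ALL bounded admissible eternal solutions, not over DSS waves.  This file records the mechanism that removes the caveat at the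
continuum level.

THE EQUATION.  In the renormalised log-time `σ` and the height `y = n·log Λ`, with `U = (log Λ)·w` (`w` = the scalar renormalised
amplitude of the dyadic member; the tree's `1/ε₀` amplitude floor says survivors live on this scale), the positive dyadic lattice
`w_n' = −w_n + Λ w_{n−1}² − Λ⁻¹ w_n w_{n+1}` is, to first order in `log Λ`, the scalar balance law

  `∂_σ U + 3 U ∂_y U = U (2U − 1)`,   characteristics `ẏ = 3U`, `U̇ = U(2U − 1)`.

The value `U = 1/2` is `(log Λ)·w⋆`, `w⋆ = 1/(Λ − Λ⁻¹)` the level of the separable (Barbato–Flandoli–Morandin) blow-up, and it is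
the SONIC value: the reaction vanishes there and the characteristic speed there is `3·(1/2) = 3/2` = the Kolmogorov front speed
(delay `T = (2/3) log Λ` per shell, wake `Λ^{2n/3}`).

* §1 `inv_sub_two_eq`, `charU_closedForm` — along a characteristic `1/U − 2 = (1/U₀ − 2)e^{σ−σ₀}` (Bernoulli), hence
  `superhalf_iff` / `subhalf_iff` / `sonic_stationary`: the SIGN of `U − 1/2` is invariant along every characteristic (forward AND
  backward); `subhalf_decay`: subsonic characteristics die like `e^{−σ}` (frozen wake); `supersonic_lifespan`: a supersonic
  characteristic lives at most `log(2U₀/(2U₀−1))` (it must be absorbed by the front shock).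
* §2 `kolmogorov_gain_of_superhalf`, `gain_le_of_subhalf`, `sonic_curve_speed` — transport: a characteristic carrying `U ≥ 1/2`
  gains height at rate `≥ 3/2`, one carrying `U ≤ 1/2` at rate `≤ 3/2`, the sonic level set at rate EXACTLY `3/2`.
* §3 **`sonic_barrier`** — if a characteristic is supersonic at time `σ₁` then it was supersonic on all of `[σ₀, σ₁]` and
  `y(σ₀) ≤ y(σ₁) − (3/2)(σ₁ − σ₀)`.  READING: supersonic values are never created (sign invariance; entropy shocks of the convex flux
  `(3/2)U²` only jump DOWN in `y`), so the left-most supersonic height `Z(σ) = inf{y : U(y,σ) > 1/2}` of an entropy solution obeys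
  `Z(σ₁) ≥ Z(σ₀) + (3/2)(σ₁ − σ₀)` (backward generalized characteristics through `{U > 1/2}` are genuine — Dafermos), the front `y_f`
  (shock into vacuum, Rankine–Hugoniot speed `(3/2)U₋`; `front_advance_le` / `front_outruns_sonic`) obeys `y_f ≥ Z` while
  `{U > 1/2} ≠ ∅`, and once `{U > 1/2} = ∅` everything decays like `e^{−σ}` and the front STALLS at finite height (`stalled_front`).
  Hence EVERY ancient entropy solution lighting arbitrarily high shells has `lim inf y_f(σ)/σ ≥ 3/2`.
* §4 dictionary with the tree's survival predicate: `speed_le_five_fourths_of_surviving` — `Surviving 1 ε₀ T` forces the front speed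
  `log Λ / T ≤ 5/4`; `not_surviving_one_of_delay_le_kolmogorov` — a delay `T ≤ (2/3) log Λ` (speed `≥ 3/2`) is NOT (S₁)-surviving.
  `3/2 > 5/4`: the sonic barrier outruns every (S₁)-survivor — the continuum form of (ρ0) on the dyadic member for all ancient
  solutions, with the same margin `a = 5/3 > 1` as the self-similar selection.

WHAT REMAINS FOR (W1) (census of this hand): (a) the LATTICE sonic barrier — for positive bounded finite-action solutions of the
dyadic member, the left-most shell with `w_n > w⋆ = 1/(Λ−Λ⁻¹)` advances at `≥ (3/2)/log Λ · (1 − o(1))` shells per unit log-time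
(the naive invariance of `{w ≤ w⋆}` FAILS inside the shock layer: a shell at level `w⋆` with an empty shell ahead has no drain and grows
at rate `Λ⁻¹/(Λ−Λ⁻¹) ≈ 1/(2 log Λ)`; a discrete sub-solution/entropy argument is needed); (b) compactness lattice → entropy solution
uniform in the solution (rescaled amplitude `(log Λ)·sup w` a priori unbounded); (c) uniformity over `E₂(R)`.
HONEST LABEL: elementary calculus; records the mechanism, proves nothing about any item; (ρ0), (ρ+), ⟨20419⟩, NS: all OPEN.
-/

noncomputable section

-- the summit and its single sub-problem share the name (CONVENTIONS §1)
set_option linter.dupNamespace false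

namespace Summit.NavierStokesRegularity.NavierStokesRegularity.Theorems.NoSurvivingEternalViscBddOne.ContinuumSonicBarrier

open Real Set

/-! ## §1 The reaction law along characteristics: `U̇ = U(2U − 1)` in closed form; sign invariance of `U − 1/2` -/

/-- Along a characteristic the inverse amplitude obeys the LINEAR law `(1/U − 2)' = 1/U − 2` (Bernoulli substitution for
`U̇ = U(2U−1) = 2U² − U`).
[folklore (method of characteristics; Bernoulli equation); cell memo W1] -/
theorem hasDerivAt_inv_sub_two {U : ℝ → ℝ} {s : ℝ} (hU : HasDerivAt U (U s * (2 * U s - 1)) s) (hpos : U s ≠ 0) :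
    HasDerivAt (fun t => (U t)⁻¹ - 2) ((U s)⁻¹ - 2) s := by
  have e : -(U s * (2 * U s - 1)) / U s ^ 2 = (U s)⁻¹ - 2 := by
    rw [div_eq_iff (pow_ne_zero 2 hpos), sub_mul, pow_two, ← mul_assoc, inv_mul_cancel₀ hpos, one_mul]
    ring
  exact ((hU.inv hpos).sub_const 2).congr_deriv e

/-- The sonic invariant: `σ ↦ (1/U(σ) − 2)·e^{−σ}` has derivative `0` along a characteristic.
[folklore (method of characteristics; integrating factor); cell memo W1] -/
theorem hasDerivAt_sonicInvariant {U : ℝ → ℝ} {s : ℝ} (hU : HasDerivAt U (U s * (2 * U s - 1)) s) (hpos : U s ≠ 0) :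
    HasDerivAt (fun t => ((U t)⁻¹ - 2) * exp (-t)) 0 s := by
  have h1 := hasDerivAt_inv_sub_two hU hpos
  have h2 : HasDerivAt (fun t => exp (-t)) (exp (-s) * (-1)) s := (hasDerivAt_neg s).exp
  have e : ((U s)⁻¹ - 2) * exp (-s) + ((U s)⁻¹ - 2) * (exp (-s) * (-1)) = 0 := by ring
  exact (h1.mul h2).congr_deriv e

/-- The sonic invariant is constant on every interval on which the characteristic law holds and `U ≠ 0`.
[folklore (method of characteristics); cell memo W1] -/
theorem sonicInvariant_const {U : ℝ → ℝ} {σ₀ σ₁ : ℝ}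
    (hU : ∀ s ∈ Icc σ₀ σ₁, HasDerivAt U (U s * (2 * U s - 1)) s) (hpos : ∀ s ∈ Icc σ₀ σ₁, U s ≠ 0) :
    ∀ s ∈ Icc σ₀ σ₁, ((U s)⁻¹ - 2) * exp (-s) = ((U σ₀)⁻¹ - 2) * exp (-σ₀) := by
  refine constant_of_has_deriv_right_zero (f := fun t => ((U t)⁻¹ - 2) * exp (-t)) ?_ ?_
  · intro t ht
    exact (hasDerivAt_sonicInvariant (hU t ht) (hpos t ht)).continuousAt.continuousWithinAt
  · intro t ht
    exact (hasDerivAt_sonicInvariant (hU t (Ico_subset_Icc_self ht))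
      (hpos t (Ico_subset_Icc_self ht))).hasDerivWithinAt

/-- **Closed form of the reaction law**, inverse form: `1/U(σ) − 2 = (1/U(σ₀) − 2)·e^{σ − σ₀}` along a characteristic.
[folklore (method of characteristics; Bernoulli equation); cell memo W1] -/
theorem inv_sub_two_eq {U : ℝ → ℝ} {σ₀ σ₁ : ℝ}
    (hU : ∀ s ∈ Icc σ₀ σ₁, HasDerivAt U (U s * (2 * U s - 1)) s) (hpos : ∀ s ∈ Icc σ₀ σ₁, U s ≠ 0)
    {s : ℝ} (hs : s ∈ Icc σ₀ σ₁) :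
    (U s)⁻¹ - 2 = ((U σ₀)⁻¹ - 2) * exp (s - σ₀) := by
  have h := sonicInvariant_const hU hpos s hs
  have h1 : exp (-s) * exp s = 1 := by rw [← exp_add]; simp
  have h2 : exp (-σ₀) * exp s = exp (s - σ₀) := by rw [← exp_add]; congr 1; ring
  calc (U s)⁻¹ - 2 = (((U s)⁻¹ - 2) * exp (-s)) * exp s := by rw [mul_assoc, h1, mul_one]
    _ = (((U σ₀)⁻¹ - 2) * exp (-σ₀)) * exp s := by rw [h]
    _ = ((U σ₀)⁻¹ - 2) * exp (s - σ₀) := by rw [mul_assoc, h2]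

/-- **Closed form of the reaction law**: `U(σ) = 1/(2 + (1/U(σ₀) − 2)·e^{σ−σ₀})` along a characteristic (positive branch).
[folklore (method of characteristics; Bernoulli equation); cell memo W1] -/
theorem charU_closedForm {U : ℝ → ℝ} {σ₀ σ₁ : ℝ}
    (hU : ∀ s ∈ Icc σ₀ σ₁, HasDerivAt U (U s * (2 * U s - 1)) s) (hpos : ∀ s ∈ Icc σ₀ σ₁, U s ≠ 0)
    {s : ℝ} (hs : s ∈ Icc σ₀ σ₁) :
    U s = (2 + ((U σ₀)⁻¹ - 2) * exp (s - σ₀))⁻¹ := by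
  have h := inv_sub_two_eq hU hpos hs
  have h' : (U s)⁻¹ = 2 + ((U σ₀)⁻¹ - 2) * exp (s - σ₀) := by linarith
  rw [← h', inv_inv]

/-- For a positive amplitude, «supersonic» `1/2 < u` reads `1/u − 2 < 0`. [elementary] -/
theorem half_lt_iff_inv_sub_two_neg {u : ℝ} (hu : 0 < u) : 1 / 2 < u ↔ u⁻¹ - 2 < 0 := by
  rw [sub_neg, inv_lt_comm₀ hu two_pos]
  norm_num

/-- For a positive amplitude, «subsonic» `u < 1/2` reads `0 < 1/u − 2`. [elementary] -/
theorem lt_half_iff_inv_sub_two_pos {u : ℝ} (hu : 0 < u) : u < 1 / 2 ↔ 0 < u⁻¹ - 2 := by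
  rw [sub_pos, lt_inv_comm₀ two_pos hu]
  norm_num

/-- **Sign invariance, supersonic side**: along a positive characteristic, `U(σ) > 1/2` at ONE time of the interval iff at its
left end — supersonic values are neither created nor destroyed by the smooth dynamics (forward and backward in log-time).
[folklore (method of characteristics); cell memo W1] -/
theorem superhalf_iff {U : ℝ → ℝ} {σ₀ σ₁ : ℝ}
    (hU : ∀ s ∈ Icc σ₀ σ₁, HasDerivAt U (U s * (2 * U s - 1)) s) (hpos : ∀ s ∈ Icc σ₀ σ₁, 0 < U s)
    {s : ℝ} (hs : s ∈ Icc σ₀ σ₁) :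
    1 / 2 < U s ↔ 1 / 2 < U σ₀ := by
  have hne : ∀ t ∈ Icc σ₀ σ₁, U t ≠ 0 := fun t ht => (hpos t ht).ne'
  have h0 : σ₀ ∈ Icc σ₀ σ₁ := left_mem_Icc.2 (hs.1.trans hs.2)
  rw [half_lt_iff_inv_sub_two_neg (hpos s hs), half_lt_iff_inv_sub_two_neg (hpos σ₀ h0),
    inv_sub_two_eq hU hne hs]
  have he : 0 < exp (s - σ₀) := exp_pos _
  constructor
  · intro h
    by_contra hc
    exact absurd h (not_lt.2 (mul_nonneg (not_lt.1 hc) he.le))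
  · intro h
    exact mul_neg_of_neg_of_pos h he

/-- **Sign invariance, subsonic side**: `U(σ) < 1/2` at one time of the interval iff at its left end.
[folklore (method of characteristics); cell memo W1] -/
theorem subhalf_iff {U : ℝ → ℝ} {σ₀ σ₁ : ℝ}
    (hU : ∀ s ∈ Icc σ₀ σ₁, HasDerivAt U (U s * (2 * U s - 1)) s) (hpos : ∀ s ∈ Icc σ₀ σ₁, 0 < U s)
    {s : ℝ} (hs : s ∈ Icc σ₀ σ₁) :
    U s < 1 / 2 ↔ U σ₀ < 1 / 2 := by
  have hne : ∀ t ∈ Icc σ₀ σ₁, U t ≠ 0 := fun t ht => (hpos t ht).ne'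
  have h0 : σ₀ ∈ Icc σ₀ σ₁ := left_mem_Icc.2 (hs.1.trans hs.2)
  rw [lt_half_iff_inv_sub_two_pos (hpos s hs), lt_half_iff_inv_sub_two_pos (hpos σ₀ h0),
    inv_sub_two_eq hU hne hs]
  have he : 0 < exp (s - σ₀) := exp_pos _
  constructor
  · intro h
    by_contra hc
    exact absurd h (not_lt.2 (mul_nonpos_of_nonpos_of_nonneg (not_lt.1 hc) he.le))
  · intro h
    exact mul_pos h he

/-- **The sonic value is stationary**: `U(σ₀) = 1/2` ⟹ `U ≡ 1/2` on the interval (the characteristic through a sonic point stays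
sonic — it IS the level set).
[folklore (method of characteristics); cell memo W1] -/
theorem sonic_stationary {U : ℝ → ℝ} {σ₀ σ₁ : ℝ}
    (hU : ∀ s ∈ Icc σ₀ σ₁, HasDerivAt U (U s * (2 * U s - 1)) s) (hpos : ∀ s ∈ Icc σ₀ σ₁, 0 < U s)
    (h0 : U σ₀ = 1 / 2) {s : ℝ} (hs : s ∈ Icc σ₀ σ₁) : U s = 1 / 2 := by
  have hne : ∀ t ∈ Icc σ₀ σ₁, U t ≠ 0 := fun t ht => (hpos t ht).ne'
  rw [charU_closedForm hU hne hs, h0]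
  norm_num

/-- **Subsonic characteristics die** (the frozen wake): if `U(σ₀) < 1/2` then
`U(σ) ≤ U(σ₀)/(1 − 2U(σ₀)) · e^{−(σ−σ₀)}` on the interval.
[folklore (method of characteristics); cell memo W1] -/
theorem subhalf_decay {U : ℝ → ℝ} {σ₀ σ₁ : ℝ}
    (hU : ∀ s ∈ Icc σ₀ σ₁, HasDerivAt U (U s * (2 * U s - 1)) s) (hpos : ∀ s ∈ Icc σ₀ σ₁, 0 < U s)
    (h0 : U σ₀ < 1 / 2) {s : ℝ} (hs : s ∈ Icc σ₀ σ₁) :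
    U s ≤ U σ₀ / (1 - 2 * U σ₀) * exp (-(s - σ₀)) := by
  have hne : ∀ t ∈ Icc σ₀ σ₁, U t ≠ 0 := fun t ht => (hpos t ht).ne'
  have hσ₀ : σ₀ ∈ Icc σ₀ σ₁ := left_mem_Icc.2 (hs.1.trans hs.2)
  have hU0 := hpos σ₀ hσ₀
  have hc : 0 < (U σ₀)⁻¹ - 2 := (lt_half_iff_inv_sub_two_pos hU0).1 h0
  have he : 0 < exp (s - σ₀) := exp_pos _
  have hinv : (U s)⁻¹ = 2 + ((U σ₀)⁻¹ - 2) * exp (s - σ₀) := by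
    have := inv_sub_two_eq hU hne hs; linarith
  -- `1/U(s) ≥ c·e^{s−σ₀}` with `c = 1/U₀ − 2 = (1 − 2U₀)/U₀`
  have hge : ((U σ₀)⁻¹ - 2) * exp (s - σ₀) ≤ (U s)⁻¹ := by rw [hinv]; linarith
  have hUs := hpos s hs
  have hce : 0 < ((U σ₀)⁻¹ - 2) * exp (s - σ₀) := mul_pos hc he
  have h1 : U s ≤ (((U σ₀)⁻¹ - 2) * exp (s - σ₀))⁻¹ := by
    rw [le_inv_comm₀ hUs hce]; exact hge
  have h12 : 0 < 1 - 2 * U σ₀ := by linarith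
  have heq : (((U σ₀)⁻¹ - 2) * exp (s - σ₀))⁻¹ = U σ₀ / (1 - 2 * U σ₀) * exp (-(s - σ₀)) := by
    rw [exp_neg]
    field_simp
  rw [← heq]; exact h1

/-- **Lifespan of a supersonic characteristic**: if `U(σ₀) > 1/2` and the (positive, smooth) characteristic law holds on
`[σ₀, σ₁]`, then `e^{σ₁−σ₀} < 2U(σ₀)/(2U(σ₀) − 1)`: supersonic characteristics blow up in finite log-time, so in a bounded (type-I)
solution they are absorbed by the front shock first.
[folklore (method of characteristics); cell memo W1] -/
theorem supersonic_lifespan {U : ℝ → ℝ} {σ₀ σ₁ : ℝ} (hle : σ₀ ≤ σ₁)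
    (hU : ∀ s ∈ Icc σ₀ σ₁, HasDerivAt U (U s * (2 * U s - 1)) s) (hpos : ∀ s ∈ Icc σ₀ σ₁, 0 < U s)
    (h0 : 1 / 2 < U σ₀) :
    exp (σ₁ - σ₀) < 2 * U σ₀ / (2 * U σ₀ - 1) := by
  have hne : ∀ t ∈ Icc σ₀ σ₁, U t ≠ 0 := fun t ht => (hpos t ht).ne'
  have hσ₁ : σ₁ ∈ Icc σ₀ σ₁ := right_mem_Icc.2 hle
  have hU0 := hpos σ₀ (left_mem_Icc.2 hle)
  have hinv : (U σ₁)⁻¹ = 2 + ((U σ₀)⁻¹ - 2) * exp (σ₁ - σ₀) := by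
    have := inv_sub_two_eq hU hne hσ₁; linarith
  have hUs : 0 < (U σ₁)⁻¹ := inv_pos.2 (hpos σ₁ hσ₁)
  have hc : (U σ₀)⁻¹ - 2 < 0 := (half_lt_iff_inv_sub_two_neg hU0).1 h0
  have h21 : 0 < 2 * U σ₀ - 1 := by linarith
  -- `0 < 2 + c e` with `c = (1 − 2U₀)/U₀ < 0` ⟹ `e < 2U₀/(2U₀ − 1)`
  have key : (2 - (U σ₀)⁻¹) * exp (σ₁ - σ₀) < 2 := by rw [hinv] at hUs; linarith
  have hc' : 0 < 2 - (U σ₀)⁻¹ := by linarith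
  rw [lt_div_iff₀ h21]
  have : (2 - (U σ₀)⁻¹) * U σ₀ = 2 * U σ₀ - 1 := by field_simp
  calc exp (σ₁ - σ₀) * (2 * U σ₀ - 1) = ((2 - (U σ₀)⁻¹) * exp (σ₁ - σ₀)) * U σ₀ := by rw [← this]; ring
    _ < 2 * U σ₀ := by nlinarith

/-! ## §2 Transport: height gained along sub-, super- and exactly sonic characteristics (`ẏ = 3U`) -/

/-- Monotonicity on `[σ₀, σ₁]` from a non-negative derivative (mean value theorem), in the pointwise-`HasDerivAt` format of this file.
[folklore (mean value theorem)] -/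
theorem le_of_hasDerivAt_nonneg {f f' : ℝ → ℝ} {σ₀ σ₁ : ℝ} (hle : σ₀ ≤ σ₁)
    (hf : ∀ s ∈ Icc σ₀ σ₁, HasDerivAt f (f' s) s) (hnn : ∀ s ∈ Icc σ₀ σ₁, 0 ≤ f' s) : f σ₀ ≤ f σ₁ := by
  have hmono : MonotoneOn f (Icc σ₀ σ₁) :=
    monotoneOn_of_hasDerivWithinAt_nonneg (convex_Icc σ₀ σ₁)
      (fun t ht => (hf t ht).continuousAt.continuousWithinAt)
      (fun t ht => (hf t (interior_subset ht)).hasDerivWithinAt)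
      (fun t ht => hnn t (interior_subset ht))
  exact hmono (left_mem_Icc.2 hle) (right_mem_Icc.2 hle) hle

/-- **Supersonic characteristics are Kolmogorov-fast**: `U ≥ 1/2` on `[σ₀, σ₁]` ⟹ `y(σ₁) ≥ y(σ₀) + (3/2)(σ₁ − σ₀)`.
[folklore (method of characteristics); cell memo W1] -/
theorem kolmogorov_gain_of_superhalf {y U : ℝ → ℝ} {σ₀ σ₁ : ℝ} (hle : σ₀ ≤ σ₁)
    (hy : ∀ s ∈ Icc σ₀ σ₁, HasDerivAt y (3 * U s) s) (hsup : ∀ s ∈ Icc σ₀ σ₁, 1 / 2 ≤ U s) :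
    y σ₀ + 3 / 2 * (σ₁ - σ₀) ≤ y σ₁ := by
  have h := le_of_hasDerivAt_nonneg (f := fun t => y t - 3 / 2 * t) (f' := fun t => 3 * U t - 3 / 2) hle
    (fun t ht => by
      have h := (hy t ht).sub ((hasDerivAt_id t).const_mul (3 / 2 : ℝ))
      simp only [id, mul_one] at h
      exact h)
    (fun t ht => by have := hsup t ht; linarith)
  linarith

/-- **Subsonic characteristics are Kolmogorov-slow**: `U ≤ 1/2` on `[σ₀, σ₁]` ⟹ `y(σ₁) ≤ y(σ₀) + (3/2)(σ₁ − σ₀)`.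
[folklore (method of characteristics); cell memo W1] -/
theorem gain_le_of_subhalf {y U : ℝ → ℝ} {σ₀ σ₁ : ℝ} (hle : σ₀ ≤ σ₁)
    (hy : ∀ s ∈ Icc σ₀ σ₁, HasDerivAt y (3 * U s) s) (hsub : ∀ s ∈ Icc σ₀ σ₁, U s ≤ 1 / 2) :
    y σ₁ ≤ y σ₀ + 3 / 2 * (σ₁ - σ₀) := by
  have h := le_of_hasDerivAt_nonneg (f := fun t => 3 / 2 * t - y t) (f' := fun t => 3 / 2 - 3 * U t) hle
    (fun t ht => by
      have h := ((hasDerivAt_id t).const_mul (3 / 2 : ℝ)).sub (hy t ht)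
      simp only [id, mul_one] at h
      exact h)
    (fun t ht => by have := hsub t ht; linarith)
  linarith

/-- **The sonic level set travels at exactly the Kolmogorov speed `3/2`**: `U ≡ 1/2` along the characteristic ⟹
`y(σ₁) = y(σ₀) + (3/2)(σ₁ − σ₀)`.
[folklore (method of characteristics); cell memo W1] -/
theorem sonic_curve_speed {y U : ℝ → ℝ} {σ₀ σ₁ : ℝ} (hle : σ₀ ≤ σ₁)
    (hy : ∀ s ∈ Icc σ₀ σ₁, HasDerivAt y (3 * U s) s) (hson : ∀ s ∈ Icc σ₀ σ₁, U s = 1 / 2) :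
    y σ₁ = y σ₀ + 3 / 2 * (σ₁ - σ₀) :=
  le_antisymm (gain_le_of_subhalf hle hy fun s hs => (hson s hs).le)
    (kolmogorov_gain_of_superhalf hle hy fun s hs => (hson s hs).ge)

/-- The sonic characteristic: if the reaction law holds, `U > 0` and `U(σ₀) = 1/2`, the characteristic gains height at exactly
rate `3/2` — the level set `{U = 1/2}` of a smooth solution moves at the Kolmogorov speed whatever the profile around it.
[folklore (method of characteristics); cell memo W1] -/
theorem sonic_levelSet_speed {y U : ℝ → ℝ} {σ₀ σ₁ : ℝ} (hle : σ₀ ≤ σ₁)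
    (hy : ∀ s ∈ Icc σ₀ σ₁, HasDerivAt y (3 * U s) s)
    (hU : ∀ s ∈ Icc σ₀ σ₁, HasDerivAt U (U s * (2 * U s - 1)) s) (hpos : ∀ s ∈ Icc σ₀ σ₁, 0 < U s)
    (h0 : U σ₀ = 1 / 2) :
    y σ₁ = y σ₀ + 3 / 2 * (σ₁ - σ₀) :=
  sonic_curve_speed hle hy fun _ hs => sonic_stationary hU hpos h0 hs

/-! ## §3 The sonic barrier and the front -/

/-- **THE SONIC BARRIER.**  Along a positive characteristic of `∂_σU + 3U∂_yU = U(2U−1)` on `[σ₀, σ₁]`: if it is supersonic at the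
END (`U(σ₁) > 1/2`) then it was supersonic throughout and came from height `y(σ₀) ≤ y(σ₁) − (3/2)(σ₁ − σ₀)`.  Consequently (module
docstring) the left-most supersonic height of an entropy solution advances at rate `≥ 3/2`, and so does every front that stays alive.
[folklore (method of characteristics); cell memo W1] -/
theorem sonic_barrier {y U : ℝ → ℝ} {σ₀ σ₁ : ℝ} (hle : σ₀ ≤ σ₁)
    (hy : ∀ s ∈ Icc σ₀ σ₁, HasDerivAt y (3 * U s) s)
    (hU : ∀ s ∈ Icc σ₀ σ₁, HasDerivAt U (U s * (2 * U s - 1)) s) (hpos : ∀ s ∈ Icc σ₀ σ₁, 0 < U s)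
    (h1 : 1 / 2 < U σ₁) :
    (∀ s ∈ Icc σ₀ σ₁, 1 / 2 < U s) ∧ y σ₀ + 3 / 2 * (σ₁ - σ₀) ≤ y σ₁ := by
  have h0 : 1 / 2 < U σ₀ := (superhalf_iff hU hpos (right_mem_Icc.2 hle)).1 h1
  have hall : ∀ s ∈ Icc σ₀ σ₁, 1 / 2 < U s := fun s hs => (superhalf_iff hU hpos hs).2 h0
  exact ⟨hall, kolmogorov_gain_of_superhalf hle hy fun s hs => (hall s hs).le⟩

/-- **Front advance under an amplitude ceiling**: if the front moves at the Rankine–Hugoniot speed `(3/2)U₋(σ)` and `U₋ ≤ u` on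
`[σ₀, σ₁]`, it gains height `≤ (3/2)u(σ₁ − σ₀)`.  With `u < 1` it is slower than the sonic barrier behind it (speed `3/2`), which
therefore catches it: the supersonic layer behind a sub-Kolmogorov front is consumed.
[folklore (Rankine–Hugoniot); cell memo W1] -/
theorem front_advance_le {yf Um : ℝ → ℝ} {σ₀ σ₁ u : ℝ} (hle : σ₀ ≤ σ₁)
    (hyf : ∀ s ∈ Icc σ₀ σ₁, HasDerivAt yf (3 / 2 * Um s) s) (hUm : ∀ s ∈ Icc σ₀ σ₁, Um s ≤ u) :
    yf σ₁ ≤ yf σ₀ + 3 / 2 * u * (σ₁ - σ₀) := by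
  have h := le_of_hasDerivAt_nonneg (f := fun t => 3 / 2 * u * t - yf t) (f' := fun t => 3 / 2 * u - 3 / 2 * Um t) hle
    (fun t ht => by
      have h := ((hasDerivAt_id t).const_mul (3 / 2 * u)).sub (hyf t ht)
      simp only [id, mul_one] at h
      exact h)
    (fun t ht => by have := hUm t ht; nlinarith)
  linarith

/-- **The barrier catches a sub-Kolmogorov front**: a front with `U₋ ≤ u < 1` on `[σ₀, σ₁]` starting a distance `d` ahead of a sonic
curve `z(σ) = z₀ + (3/2)(σ − σ₀)` is reached by it as soon as `(3/2)(1 − u)(σ₁ − σ₀) ≥ d`.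
[folklore (Rankine–Hugoniot, method of characteristics); cell memo W1] -/
theorem sonic_catches_front {yf Um : ℝ → ℝ} {σ₀ σ₁ u z₀ : ℝ} (hle : σ₀ ≤ σ₁)
    (hyf : ∀ s ∈ Icc σ₀ σ₁, HasDerivAt yf (3 / 2 * Um s) s) (hUm : ∀ s ∈ Icc σ₀ σ₁, Um s ≤ u)
    (hd : yf σ₀ - z₀ ≤ 3 / 2 * (1 - u) * (σ₁ - σ₀)) :
    yf σ₁ ≤ z₀ + 3 / 2 * (σ₁ - σ₀) := by
  have h := front_advance_le hle hyf hUm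
  nlinarith

/-- **A Kolmogorov-strong front outruns the barrier**: `U₋ ≥ 1` on `[σ₀, σ₁]` ⟹ the front gains height `≥ (3/2)(σ₁ − σ₀)` (the
self-similar Kolmogorov front has `U₋ = 1` exactly).
[folklore (Rankine–Hugoniot); cell memo W1] -/
theorem front_outruns_sonic {yf Um : ℝ → ℝ} {σ₀ σ₁ : ℝ} (hle : σ₀ ≤ σ₁)
    (hyf : ∀ s ∈ Icc σ₀ σ₁, HasDerivAt yf (3 / 2 * Um s) s) (hUm : ∀ s ∈ Icc σ₀ σ₁, 1 ≤ Um s) :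
    yf σ₀ + 3 / 2 * (σ₁ - σ₀) ≤ yf σ₁ := by
  have hy : ∀ s ∈ Icc σ₀ σ₁, HasDerivAt yf (3 * (Um s / 2)) s := by
    intro s hs; convert hyf s hs using 1; ring
  exact kolmogorov_gain_of_superhalf hle hy fun s hs => by have := hUm s hs; linarith

/-- **A front fed by a dying (subsonic) layer stalls**: if `U₋(σ) ≤ u₀ e^{−κ(σ−σ₀)}` (`κ > 0`, `u₀ ≥ 0`) then the total advance of the
front on `[σ₀, σ₁]` is `≤ 3u₀/(2κ)`, uniformly in `σ₁` — no shell above that height is ever lit, so the solution is not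
(S₁)-surviving (survival lights arbitrarily high shells).
[folklore (Rankine–Hugoniot); cell memo W1] -/
theorem stalled_front {yf Um : ℝ → ℝ} {σ₀ σ₁ u₀ κ : ℝ} (hle : σ₀ ≤ σ₁) (hκ : 0 < κ) (hu₀ : 0 ≤ u₀)
    (hyf : ∀ s ∈ Icc σ₀ σ₁, HasDerivAt yf (3 / 2 * Um s) s)
    (hUm : ∀ s ∈ Icc σ₀ σ₁, Um s ≤ u₀ * exp (-(κ * (s - σ₀)))) :
    yf σ₁ ≤ yf σ₀ + 3 * u₀ / (2 * κ) := by
  have hg : ∀ t, HasDerivAt (fun t => 3 * u₀ / (2 * κ) * exp (-(κ * (t - σ₀))))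
      (3 * u₀ / (2 * κ) * (exp (-(κ * (t - σ₀))) * (-κ))) t := by
    intro t
    have h1 : HasDerivAt (fun t => -(κ * (t - σ₀))) (-κ) t := by
      have h := (((hasDerivAt_id t).sub_const σ₀).const_mul κ).neg
      simp only [id, mul_one] at h
      exact h
    exact h1.exp.const_mul _
  have h := le_of_hasDerivAt_nonneg (f := fun t => -yf t - 3 * u₀ / (2 * κ) * exp (-(κ * (t - σ₀))))
    (f' := fun t => -(3 / 2 * Um t) - 3 * u₀ / (2 * κ) * (exp (-(κ * (t - σ₀))) * (-κ))) hle
    (fun t ht => ((hyf t ht).neg).sub (hg t))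
    (fun t ht => by
      have h := hUm t ht
      have : 3 * u₀ / (2 * κ) * (exp (-(κ * (t - σ₀))) * (-κ)) = -(3 / 2) * (u₀ * exp (-(κ * (t - σ₀)))) := by
        field_simp
      rw [this]
      linarith)
  simp only [sub_self, mul_zero, neg_zero, exp_zero, mul_one] at h
  have hpos : 0 ≤ 3 * u₀ / (2 * κ) * exp (-(κ * (σ₁ - σ₀))) := by positivity
  linarith

/-! ## §4 Dictionary with the lattice survival predicate -/

open Literature.Analysis.FluidPDE Literature.Analysis.FluidPDE.TaoCascade
open Summit.NavierStokesRegularity.NavierStokesRegularity.Theorems.NoSurvivingEternalViscBddOne.Continuum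
  (surviving_one_iff_frontExponent)

/-- `log Λ > 0` for `ε₀ > 0` (`Λ = bigLam ε₀ = (1+ε₀)^{5/2} > 1`).
[cite: Tao2016AveragedNS, §4 (4.1) (the weight `(1+ε₀)^{5n/2}`); elementary] -/
theorem log_bigLam_pos {ε₀ : ℝ} (hε : 0 < ε₀) : 0 < log (bigLam ε₀) :=
  Real.log_pos (Real.one_lt_rpow (by linarith) (by norm_num))

/-- **(S₁)-survivors are slow**: `Surviving 1 ε₀ T` forces the front speed `log Λ / T ≤ 5/4` (in `y = n log Λ` per unit log-time),
i.e. `T ≥ (4/5) log Λ = 2 log(1+ε₀)`.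
[cite: Tao2016AveragedNS, §4 (4.1) and the viscous equation before Thm. 4.2 (the weights behind `Surviving`); cell vocabulary; elementary] -/
theorem speed_le_five_fourths_of_surviving {ε₀ T : ℝ} (hε : 0 < ε₀) (hT : 0 < T) (hS : Surviving 1 ε₀ T) :
    log (bigLam ε₀) / T ≤ 5 / 4 := by
  have h := ((surviving_one_iff_frontExponent hε hT).1 hS).2
  have : 2 * log (bigLam ε₀) / T = 2 * (log (bigLam ε₀) / T) := by ring
  rw [this] at h
  linarith

/-- **The sonic barrier outruns every (S₁)-survivor**: a delay `T ≤ (2/3) log Λ` per shell (front speed `≥ 3/2`, Kolmogorov or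
faster — what the barrier forces on every ancient front that stays alive, module docstring) is NOT (S₁)-surviving; the margin is
`3/2 > 5/4` (equivalently wake exponent `5/3 > 1`, tree `kolmogorov_rate_exceeds_threshold`).
[cite: Tao2016AveragedNS, §4 (4.1) and the viscous equation before Thm. 4.2 (the weights behind `Surviving`); cell vocabulary; elementary] -/
theorem not_surviving_one_of_delay_le_kolmogorov {ε₀ T : ℝ} (hε : 0 < ε₀) (hT : 0 < T)
    (hK : T ≤ 2 / 3 * log (bigLam ε₀)) : ¬ Surviving 1 ε₀ T := by
  intro hS
  have h := speed_le_five_fourths_of_surviving hε hT hS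
  have hL := log_bigLam_pos hε
  rw [div_le_iff₀ hT] at h
  linarith

end Summit.NavierStokesRegularity.NavierStokesRegularity.Theorems.NoSurvivingEternalViscBddOne.ContinuumSonicBarrier

end
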